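import Literature.AlgebraicGeometry.HodgeTheory.GenericallyFramedChernClasses
import Literature.AlgebraicTopology.CharacteristicClasses.IndependentSectionsChernClasses
import HarnessLib

/-!
# Chern classes of a bundle with `k` independent sections off `Z` are supported on `Z`

For `X` smooth projective over `ℂ`, a complex topological vector bundle `E` of rank `r` on `X(ℂ)`,
a Zariski-closed `Z ⊆ X` and `k` continuous sections `σ₁, …, σ_k` of `E` over `(X ∖ Z)(ℂ)` which
are linearly independent in every fibre: the Chern classes `cᵢ(E)`, `i ≥ r - k + 1`, restrict to
zero on `(X ∖ Z)(ℂ)` (`chernClassZ_restrictToCompl_eq_zero_of_sections`, integrally;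
`chernClassIn_restrictToCompl_eq_zero_of_sections`, any coefficients), hence lie in the coniveau
piece `Nᵖ H²ⁱ(X(ℂ); R)` as soon as every point of `Z` has codimension `≥ p`
(`chernClassIn_mem_coniveauFiltration_of_sections`), in particular in
`algebraicClasses X i = Nⁱ H²ⁱ(X(ℂ); ℂ)` when `codim Z ≥ i`
(`chernClassIn_complex_mem_algebraicClasses_of_sections`).

This is the topological half of the classical proof that `cᵢ(E)` of an algebraic vector bundle is
algebraic (the degeneracy locus `Z = D(s₁, …, s_{r-i+1})` of `r - i + 1` general sections of a
globally generated bundle has codimension `i`, and off `Z` the sections are independent; Fulton,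
*Intersection Theory*, Ex. 14.4.1 / Thm. 14.4; the algebraic half is Kleiman–Bertini). It extends the
tree's frame case (`k = r`, `GenericallyFramedChernClasses`: `cᵢ ∈ N¹`) using Milnor–Stasheff §4
Prop. 4 / §14 (`IndependentSectionsChernClasses`). Everything is proved; no definitions, no named
facts.

## References

* [MilnorStasheff1974] J. Milnor, J. Stasheff, *Characteristic Classes* (1974), §4 Prop. 4, §14.
* [BlochOgus1974ENS] S. Bloch, A. Ogus, *Gersten's conjecture and the homology of schemes* (1974), (3.8).
* [Fulton1998] W. Fulton, *Intersection Theory*, 2nd ed. (1998), §14.4 (Thm. 14.4, Ex. 14.4.1).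
* [HusemollerFibreBundles1994] D. Husemoller, *Fibre Bundles*, 3rd ed. (1994), Ch. 17 §3 (C₁).
-/

noncomputable section

open Bundle Topology
open Literature.AlgebraicTopology.SingularHomology Literature.AlgebraicTopology.CharacteristicClasses
open Literature.AlgebraicGeometry.Motives AlgebraicGeometry

namespace Literature.AlgebraicGeometry.HodgeTheory

variable {n : ℕ} {X : SchemeOver ℂ}

/-- **`cᵢ(E)|_{(X∖Z)(ℂ)} = 0` for `i ≥ rank E - k + 1` when `E` has `k` independent sections off `Z`**
(integral classes): naturality (C₁) `cᵢ(E)| = cᵢ(E|)` and Milnor–Stasheff §4 Prop. 4 / §14 for the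
restricted bundle over the paracompact Hausdorff `(X ∖ Z)(ℂ)`.
[cite: MilnorStasheff1974, §4 Prop. 4 and §14] [cite: HusemollerFibreBundles1994, Ch. 17 §3 (C₁)] -/
theorem chernClassZ_restrictToCompl_eq_zero_of_sections (hX : IsSmoothProjective n X)
    (E : ComplexVectorBundle.{0, 0} (ComplexPoints X)) {Z : Set X.left} (hZ : IsClosed Z) {m : ℕ}
    (σ : Fin m → (P : complexPointsCompl X Z) → E.E P.1)
    (hσc : ∀ k, Continuous fun P : complexPointsCompl X Z ↦ (⟨P.1, σ k P⟩ : TotalSpace E.F E.E))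
    (hσ : ∀ P : complexPointsCompl X Z, LinearIndependent ℂ (fun k ↦ σ k P))
    {i : ℕ} (hi : E.rank < i + m) (hi0 : 0 < i) :
    restrictToCompl ℤ X (2 * i) Z (chernClassZ E i) = 0 := by
  haveI := ComplexPoints.t2Space_of_isSmoothProjective hX
  haveI := paracompactSpace_complexPoints_of_isSmoothProjective hX
  haveI := paracompactSpace_complexPointsCompl_of_isSmoothProjective hX hZ
  let f : C(complexPointsCompl X Z, ComplexPoints X) := ⟨Subtype.val, continuous_subtype_val⟩
  have hnat : chernClassZ (E.pullback f) i = singularCohomology.map ℤ ℤ f (2 * i) (chernClassZ E i) :=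
    theChernClassTheory.chernClass_pullback f E i
  have hσc' : ∀ k, Continuous fun P : complexPointsCompl X Z ↦
      (⟨P, σ k P⟩ : TotalSpace (E.pullback f).F (E.pullback f).E) :=
    fun k ↦ continuous_section_pullback_of_continuous E Z (σ k) (hσc k)
  have h0 : chernClassZ (E.pullback f) i = 0 :=
    (E.pullback f).chernClassZ_eq_zero_of_sections (fun k P ↦ σ k P) hσc' hσ
      (by rw [ComplexVectorBundle.rank_pullback]; exact hi) hi0
  change singularCohomology.map ℤ ℤ f (2 * i) (chernClassZ E i) = 0
  rw [← hnat, h0]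

/-- **The same with coefficients in any commutative ring `R`** (`cᵢ(E)_R` is the image of the
integral class, and change of coefficients commutes with restriction).
[cite: MilnorStasheff1974, §4 Prop. 4 and §14] [cite: HusemollerFibreBundles1994, Ch. 20 §4] -/
theorem chernClassIn_restrictToCompl_eq_zero_of_sections (hX : IsSmoothProjective n X) (R : Type) [CommRing R]
    (E : ComplexVectorBundle.{0, 0} (ComplexPoints X)) {Z : Set X.left} (hZ : IsClosed Z) {m : ℕ}
    (σ : Fin m → (P : complexPointsCompl X Z) → E.E P.1)
    (hσc : ∀ k, Continuous fun P : complexPointsCompl X Z ↦ (⟨P.1, σ k P⟩ : TotalSpace E.F E.E))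
    (hσ : ∀ P : complexPointsCompl X Z, LinearIndependent ℂ (fun k ↦ σ k P))
    {i : ℕ} (hi : E.rank < i + m) (hi0 : 0 < i) :
    restrictToCompl R X (2 * i) Z (theChernClassTheory.chernClassIn R E i) = 0 := by
  have h := chernClassZ_restrictToCompl_eq_zero_of_sections hX E hZ σ hσc hσ hi hi0
  change singularCohomology.map R R _ (2 * i)
    (singularCohomology.ringChange (Int.castRingHom R) (ComplexPoints X) (2 * i) (chernClassZ E i)) = 0
  rw [← ringChange_map]
  change singularCohomology.ringChange (Int.castRingHom R) _ (2 * i)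
    (restrictToCompl ℤ X (2 * i) Z (chernClassZ E i)) = 0
  rw [h, map_zero]

/-- **`cᵢ(E)_R ∈ Nᵖ H²ⁱ(X(ℂ); R)`** when `E` has `k` independent continuous sections off a Zariski
closed `Z` all of whose points have codimension `≥ p`, for `i ≥ rank E - k + 1`, `i ≥ 1`
(Bloch–Ogus (3.8): the defining generators of the coniveau filtration).
[cite: BlochOgus1974ENS, (3.8)] [cite: MilnorStasheff1974, §4 Prop. 4 and §14] -/
theorem chernClassIn_mem_coniveauFiltration_of_sections (hX : IsSmoothProjective n X) (R : Type) [CommRing R]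
    (E : ComplexVectorBundle.{0, 0} (ComplexPoints X)) {Z : Set X.left} (hZ : IsClosed Z) {p : ℕ}
    (hp : ∀ z ∈ Z, (p : ℕ∞) ≤ Order.coheight z) {m : ℕ}
    (σ : Fin m → (P : complexPointsCompl X Z) → E.E P.1)
    (hσc : ∀ k, Continuous fun P : complexPointsCompl X Z ↦ (⟨P.1, σ k P⟩ : TotalSpace E.F E.E))
    (hσ : ∀ P : complexPointsCompl X Z, LinearIndependent ℂ (fun k ↦ σ k P))
    {i : ℕ} (hi : E.rank < i + m) (hi0 : 0 < i) :
    theChernClassTheory.chernClassIn R E i ∈ coniveauFiltration R X (2 * i) p :=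
  mem_coniveauFiltration_of_restrictToCompl_eq_zero (A := R) (q := 2 * i) hZ hp
    (chernClassIn_restrictToCompl_eq_zero_of_sections hX R E hZ σ hσc hσ hi hi0)

/-- **`cᵢ(E)_ℂ ∈ algebraicClasses X i = Nⁱ H²ⁱ(X(ℂ); ℂ)`** when `E` has `rank E - i + 1` (or more)
independent continuous sections off a Zariski closed `Z` of codimension `≥ i` — the topological half
of the algebraicity of the Chern classes of algebraic vector bundles via degeneracy loci.
[cite: Fulton1998, Thm. 14.4 and Example 14.4.1] [cite: BlochOgus1974ENS, (3.8)]
[cite: MilnorStasheff1974, §4 Prop. 4 and §14] -/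
theorem chernClassIn_complex_mem_algebraicClasses_of_sections (hX : IsSmoothProjective n X)
    (E : ComplexVectorBundle.{0, 0} (ComplexPoints X)) {Z : Set X.left} (hZ : IsClosed Z) {i : ℕ}
    (hcodim : ∀ z ∈ Z, (i : ℕ∞) ≤ Order.coheight z) {m : ℕ}
    (σ : Fin m → (P : complexPointsCompl X Z) → E.E P.1)
    (hσc : ∀ k, Continuous fun P : complexPointsCompl X Z ↦ (⟨P.1, σ k P⟩ : TotalSpace E.F E.E))
    (hσ : ∀ P : complexPointsCompl X Z, LinearIndependent ℂ (fun k ↦ σ k P))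
    (hi : E.rank < i + m) (hi0 : 0 < i) :
    theChernClassTheory.chernClassIn ℂ E i ∈ algebraicClasses X i :=
  chernClassIn_mem_coniveauFiltration_of_sections hX ℂ E hZ hcodim σ hσc hσ hi hi0

end Literature.AlgebraicGeometry.HodgeTheory

end
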